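import Summits.MatrixMultiplication.MatrixMultiplication.Theorems.ObstructionDescentIrreducibleTypes

set_option linter.dupNamespace false
set_option autoImplicit false

/-!
# Obstruction descent — THIN TYPES NEVER OBSTRUCT: the residual of `P_O` is FAT in every slot (decomp-mm · lens 3 · gen 47, def-free)

`route-MatrixMultiplication-ObstructionDescent`, crux `NoOccurrenceObstruction` (`P_O`, stmt 29040); NODE-g47 §1.
Call slot `s` of a type `Λ : Fin 3 → Fin m → ℕ` **THIN at the cell `(n, m)`** if every part satisfies `λ⁽ˢ⁾_a · n² ≤ m`
(e.g. a rectangular slot `(δ^N)` of width `δ ≤ m/n²`, in particular of width `δ ≤ n^{τ-2}` at every scale `m ≥ n^τ`), and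
**FAT** otherwise (some part `> m/n²`).  The `τ`-clause of `P_O` at `(n, m)` for `(Λ, d)` —
`HWV_{Λ,d} ≤ I(GL_m³·⟨m⟩) ⟹ HWV_{Λ,d} ≤ I(GL_m³·pad_m⟨n,n,n⟩)` — is a THEOREM whenever ONE slot is thin
(`clause_of_thinSlot`): a thin slot with more than `n²` parts is pad inheritance
(`hwvSpace_le_orbitVanishing_padMM_of_lt_card`), and a thin slot with at most `n²` parts forces, by the slot-sum law
`Σ_a λ⁽ˢ⁾_a = d` of live types (`sum_eq_degree_of_hwvSpace_ne_bot`), the degree bound `d·n² ≤ n²·m`, i.e. `d ≤ m`, where no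
type obstructs (prolongation, `hwvSpace_eq_bot_of_degree_le`).  Consequences recorded here, all sorry-free over tree names:

* `noOccurrenceObstruction_boundedWidth` — for every fixed `δ₀`, the restriction of `P_O` to types with a slot of width
  `≤ δ₀` HOLDS (with `n₀ = ⌈δ₀^{1/(τ-2)}⌉`); in particular the two-rectangular sub-family `h₁^{2-rect}` of NODE-g45 §4
  (`Λ⁽⁰⁾ = Λ⁽¹⁾ = (2^N)`, any `N`, any third slot) and every fixed-width sector `((δ^N),(δ^N),ν)` are literal sub-families of
  `P_O` that are theorems AS STATED IN THE ITEM (no Goodman–Wallach duality, no Kronecker tables): `clause_of_rectangularSlot`,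
  `noOccurrenceObstruction_twoRectangular`;
* `noOccurrenceObstruction_iff_fatCore` — the gen-26 localisation `P_O ⟺ P_O|core` (`noOccurrenceObstruction_iff_core`:
  `τ < 4`, `d > m`, `≤ n²` parts per slot, `> m` part-pairs per slot pair) acquires FATNESS IN EVERY SLOT for free:
  `P_O` is equivalent to its restriction to window types having, in each of the three slots, a part `λ⁽ˢ⁾_a` with
  `λ⁽ˢ⁾_a · n² > m` AND more than `m/n²` non-zero parts (`ℓ_s · n² > m`): an occurrence obstruction against `ω = 2` is a type all
  three of whose Young diagrams are wider AND taller than `m/n² ≥ n^{τ-2} → ∞`, of mean part size `d/n² > m/n²`.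

Reading (NODE-g47 §2): an obstruction against `⟨m⟩` needs degree `d > m`, i.e. MEAN part size `d/N > m/N` over its `N` letters;
every universal occurrence obstruction in the tree — BI 2011 Lemma 6.1 `((5,1,1,1),(2⁴),(2⁴)) ⊢ 8`, the hook cubes
`((κ+1,1^{2κ}))³ ⊢ 3κ+1`, the Koszul type `((5,5,5),(3⁵),(3⁵)) ⊢ 15`, Strassen's `((6,3,3),(4,4,4),(4,4,4)) ⊢ 12`, the three-column
cubes `((3^N))³`, the boundary of the two-rectangular sector `((2^N),(2^N),ν)` — has mean part size `≤ 4`, whereas the cells of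
`P_O` (`N = n²` letters, `m ≥ n^τ`) only see types of mean part size `> m/n² ≥ n^{τ-2} → ∞`: the sector ladder K23–K36 decides
EXACT small universal-occurrence thresholds `u(N)` but no instance of the residual of `P_O`, and the only fat family charted so far
is the diagonal one, the cube levels `((k^N))³` (parts L–AF of this series).  No definition is introduced ("thin"/"fat" are
inlined); no `def`; sorry-free; axioms `propext`, `Classical.choice`, `Quot.sound`.  Nothing here proves `ω = 2` or closes an item.
[cite: BurgisserIkenmeyer2011, §3.1, Lemma 6.1, §7] [cite: BurgisserIkenmeyer2013, §4.4] [cite: Blaser2013, §5]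
-/

noncomputable section

open scoped BigOperators

namespace Summit.MatrixMultiplication.MatrixMultiplication.Theorems.ObstructionDescentThinTypes

open Literature.Computability.AlgebraicComplexity (unitTensor)
open Summit.MatrixMultiplication.MatrixMultiplication.Theorems.ObstructionCalculus
open Summit.MatrixMultiplication.MatrixMultiplication.Theses.ObstructionDescent (NoOccurrenceObstruction)
open Summit.MatrixMultiplication.MatrixMultiplication.Theorems.ObstructionDescentInformationAxis
  (noOccurrenceObstruction_iff)
open Summit.MatrixMultiplication.MatrixMultiplication.Theorems.ObstructionDescentCoreWindow
  (noOccurrenceObstruction_iff_core)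
open Summit.MatrixMultiplication.MatrixMultiplication.Theorems.ObstructionDescentIrreducibleTypes
  (sum_eq_degree_of_hwvSpace_ne_bot)

/-! ### §1 · Weight arithmetic of a thin slot -/

/-- If every part of slot `s` satisfies `λ⁽ˢ⁾_a · k ≤ B`, then `(Σ_a λ⁽ˢ⁾_a) · k ≤ #{a : λ⁽ˢ⁾_a ≠ 0} · B`. [bookkeeping] -/
theorem sum_mul_le_card_mul {m : ℕ} (w : Fin m → ℕ) {k B : ℕ} (hB : ∀ a, w a * k ≤ B) :
    (∑ a, w a) * k ≤ (Finset.univ.filter fun a => w a ≠ 0).card * B := by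
  classical
  rw [← Finset.sum_filter_ne_zero, Finset.sum_mul]
  calc ∑ a ∈ Finset.univ.filter (fun a => w a ≠ 0), w a * k
      ≤ ∑ _a ∈ Finset.univ.filter (fun a => w a ≠ 0), B := Finset.sum_le_sum fun a _ => hB a
    _ = (Finset.univ.filter fun a => w a ≠ 0).card * B := by rw [Finset.sum_const, smul_eq_mul]

/-- **Thin slot with few parts ⟹ small degree.**  A live type (`HWV_{Λ,d} ≠ ⊥`) with at most `n²` parts in a slot all of whose
parts satisfy `λ⁽ˢ⁾_a · n² ≤ m` has degree `d ≤ m` (slot-sum law `Σ_a λ⁽ˢ⁾_a = d`). [this node] -/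
theorem degree_le_of_thinSlot {n m : ℕ} {Λ : Fin 3 → Fin m → ℕ} {d : ℕ} (hne : hwvSpace Λ d ≠ ⊥) (s : Fin 3)
    (hcard : (Finset.univ.filter fun a => Λ s a ≠ 0).card ≤ n * n) (hthin : ∀ a, Λ s a * (n * n) ≤ m) : d ≤ m := by
  classical
  have hsum : ∑ a, Λ s a = d := sum_eq_degree_of_hwvSpace_ne_bot hne s
  have hle : d * (n * n) ≤ (n * n) * m := by
    rw [← hsum]
    exact (sum_mul_le_card_mul (Λ s) hthin).trans (Nat.mul_le_mul_right _ hcard)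
  rcases Nat.eq_zero_or_pos (n * n) with h0 | hpos
  · -- no room for a non-zero part: the slot is zero, so `d = 0`
    have hempty : (Finset.univ.filter fun a => Λ s a ≠ 0) = ∅ := by
      rw [← Finset.card_eq_zero]; omega
    have hzero : ∀ a, Λ s a = 0 := fun a => by
      by_contra ha
      have : a ∈ Finset.univ.filter (fun a => Λ s a ≠ 0) := Finset.mem_filter.2 ⟨Finset.mem_univ _, ha⟩
      rw [hempty] at this
      exact Finset.notMem_empty _ this
    rw [← hsum, Finset.sum_eq_zero fun a _ => hzero a]
    exact Nat.zero_le _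
  · rw [Nat.mul_comm (n * n) m] at hle
    exact Nat.le_of_mul_le_mul_right hle hpos

/-- **Live window types are fat in every slot.**  A live type with at most `n²` parts per slot and degree `d > m` has, in EVERY
slot, a part with `λ⁽ˢ⁾_a · n² > m`. [this node] -/
theorem exists_fat_part_of_window {n m : ℕ} {Λ : Fin 3 → Fin m → ℕ} {d : ℕ} (hne : hwvSpace Λ d ≠ ⊥)
    (hparts : ∀ s, (Finset.univ.filter fun a => Λ s a ≠ 0).card ≤ n * n) (hd : m < d) (s : Fin 3) :
    ∃ a, m < Λ s a * (n * n) := by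
  by_contra h
  simp only [not_exists, not_lt] at h
  exact absurd (degree_le_of_thinSlot hne s (hparts s) h) (not_le.2 hd)

/-- **Window types are tall in every slot.**  If every slot has at most `n²` parts and every slot pair has more than `m`
part-pairs, then every slot has more than `m/n²` parts: `ℓ_s · n² > m`. [this node] -/
theorem rows_mul_sq_gt_of_window {n m : ℕ} {Λ : Fin 3 → Fin m → ℕ}
    (hparts : ∀ s, (Finset.univ.filter fun a => Λ s a ≠ 0).card ≤ n * n)
    (h01 : m < (Finset.univ.filter fun a => Λ 0 a ≠ 0).card * (Finset.univ.filter fun a => Λ 1 a ≠ 0).card)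
    (h02 : m < (Finset.univ.filter fun a => Λ 0 a ≠ 0).card * (Finset.univ.filter fun a => Λ 2 a ≠ 0).card)
    (s : Fin 3) : m < (Finset.univ.filter fun a => Λ s a ≠ 0).card * (n * n) := by
  fin_cases s
  · exact h01.trans_le (Nat.mul_le_mul_left _ (hparts 1))
  · exact h01.trans_le ((Nat.mul_comm _ _).le.trans (Nat.mul_le_mul_left _ (hparts 0)))
  · exact h02.trans_le ((Nat.mul_comm _ _).le.trans (Nat.mul_le_mul_left _ (hparts 0)))

/-! ### §2 · The clause of `P_O` at a thin slot -/

/-- **THIN SLOTS NEVER OBSTRUCT (clause level, no `τ`, no `n₀`).**  At every cell `n² ≤ m`, for every type `Λ`, degree `d`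
and slot `s` with `λ⁽ˢ⁾_a · n² ≤ m` for all `a`: if all weight vectors of type `(Λ,d)` vanish on `GL_m³·⟨m⟩` then they vanish on
`GL_m³·pad_m⟨n,n,n⟩` — by pad inheritance (more than `n²` parts) or by prolongation (`d ≤ m`). [this node] -/
theorem clause_of_thinSlot {n m : ℕ} (h : n * n ≤ m) (Λ : Fin 3 → Fin m → ℕ) (d : ℕ) (s : Fin 3)
    (hthin : ∀ a, Λ s a * (n * n) ≤ m) (hU : hwvSpace Λ d ≤ orbitVanishing (unitTensor ℂ m)) :
    hwvSpace Λ d ≤ orbitVanishing (padMM ℂ n m h) := by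
  by_cases hcard : n * n < (Finset.univ.filter fun a => Λ s a ≠ 0).card
  · exact hwvSpace_le_orbitVanishing_padMM_of_lt_card h Λ d hcard
  by_cases hne : hwvSpace Λ d = ⊥
  · rw [hne]; exact bot_le
  · rw [hwvSpace_eq_bot_of_degree_le (degree_le_of_thinSlot hne s (le_of_not_gt hcard) hthin) hU]
    exact bot_le

/-- **Bounded width.**  A slot of width `≤ δ` (all parts `≤ δ`) with `δ·n² ≤ m` is thin: the clause holds. [this node] -/
theorem clause_of_width_le {n m : ℕ} (h : n * n ≤ m) (Λ : Fin 3 → Fin m → ℕ) (d : ℕ) (s : Fin 3) {δ : ℕ}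
    (hδ : δ * (n * n) ≤ m) (hwidth : ∀ a, Λ s a ≤ δ) (hU : hwvSpace Λ d ≤ orbitVanishing (unitTensor ℂ m)) :
    hwvSpace Λ d ≤ orbitVanishing (padMM ℂ n m h) :=
  clause_of_thinSlot h Λ d s (fun a => (Nat.mul_le_mul_right _ (hwidth a)).trans hδ) hU

/-- **Rectangular slots.**  A rectangular slot `(δ^N)` — every part `0` or `δ`, any number `N` of parts, in any positions —
with `δ·n² ≤ m` never obstructs: the clause of `P_O` holds at `(n, m)` for every degree and whatever the other two slots are.
In particular every fixed-width two-rectangular sector `((δ^N),(δ^N),ν)` lies outside the residual of `P_O` at all cells with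
`m ≥ δ n²`. [this node] -/
theorem clause_of_rectangularSlot {n m : ℕ} (h : n * n ≤ m) (Λ : Fin 3 → Fin m → ℕ) (d : ℕ) (s : Fin 3) {δ : ℕ}
    (hδ : δ * (n * n) ≤ m) (hrect : ∀ a, Λ s a = 0 ∨ Λ s a = δ) (hU : hwvSpace Λ d ≤ orbitVanishing (unitTensor ℂ m)) :
    hwvSpace Λ d ≤ orbitVanishing (padMM ℂ n m h) :=
  clause_of_width_le h Λ d s hδ (fun a => by rcases hrect a with ha | ha <;> simp [ha]) hU

/-- For `0 < n`: `n^{τ-2} · n² = n^τ` (real powers). [bookkeeping] -/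
theorem rpow_sub_two_mul_sq {n : ℕ} (hn : 0 < n) (τ : ℝ) :
    (n : ℝ) ^ (τ - 2) * ((n : ℝ) * (n : ℝ)) = (n : ℝ) ^ τ := by
  have hn' : (0 : ℝ) < (n : ℝ) := by exact_mod_cast hn
  have h2 : ((n : ℝ) * (n : ℝ)) = (n : ℝ) ^ (2 : ℝ) := by
    rw [show (2 : ℝ) = ((2 : ℕ) : ℝ) by norm_num, Real.rpow_natCast, pow_two]
  rw [h2, ← Real.rpow_add hn']
  ring_nf

/-- **Parts below the scale exponent.**  At a scale `m ≥ n^τ`, a slot all of whose parts are `≤ n^{τ-2}` is thin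
(`λ_a · n² ≤ n^{τ-2}·n² = n^τ ≤ m`), so the clause holds. [this node] -/
theorem clause_of_parts_le_rpow {τ : ℝ} {n m : ℕ} (h : n * n ≤ m) (hτm : (n : ℝ) ^ τ ≤ (m : ℝ))
    (Λ : Fin 3 → Fin m → ℕ) (d : ℕ) (s : Fin 3) (hthin : ∀ a, (Λ s a : ℝ) ≤ (n : ℝ) ^ (τ - 2))
    (hU : hwvSpace Λ d ≤ orbitVanishing (unitTensor ℂ m)) : hwvSpace Λ d ≤ orbitVanishing (padMM ℂ n m h) := by
  refine clause_of_thinSlot h Λ d s (fun a => ?_) hU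
  rcases Nat.eq_zero_or_pos n with rfl | hn
  · simp
  · have hnn : (0 : ℝ) ≤ (n : ℝ) * (n : ℝ) := by positivity
    have : (Λ s a : ℝ) * ((n : ℝ) * (n : ℝ)) ≤ (m : ℝ) :=
      ((mul_le_mul_of_nonneg_right (hthin a) hnn).trans_eq (rpow_sub_two_mul_sq hn τ)).trans hτm
    exact_mod_cast this

/-! ### §3 · Literal sub-families of `P_O` that are theorems -/

/-- **The thin sub-family of `P_O` holds outright** (same binders as the structured reading `noOccurrenceObstruction_iff`, with
`n₀ = 0`): at every `τ`, every cell `n² ≤ m`, `n^τ ≤ m`, every type with a thin slot. [this node] -/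
theorem noOccurrenceObstruction_thin :
    ∀ τ : ℝ, 2 < τ → ∀ n m : ℕ, ∀ h : n * n ≤ m, (n : ℝ) ^ τ ≤ (m : ℝ) →
      ∀ (Λ : Fin 3 → Fin m → ℕ) (d : ℕ), (∃ s, ∀ a, Λ s a * (n * n) ≤ m) →
        hwvSpace Λ d ≤ orbitVanishing (unitTensor ℂ m) → hwvSpace Λ d ≤ orbitVanishing (padMM ℂ n m h) :=
  fun _ _ _ _ h _ Λ d ⟨s, hs⟩ hU => clause_of_thinSlot h Λ d s hs hU

/-- Eventually in `n`, `δ₀ ≤ n^{τ-2}` (for `τ > 2`): from `n₀ = ⌈δ₀^{1/(τ-2)}⌉` on. [bookkeeping] -/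
theorem eventually_le_rpow_sub_two (δ₀ : ℕ) {τ : ℝ} (hτ : 2 < τ) :
    ∃ n₀ : ℕ, ∀ n : ℕ, n₀ ≤ n → (δ₀ : ℝ) ≤ (n : ℝ) ^ (τ - 2) := by
  have hτ' : 0 < τ - 2 := sub_pos.2 hτ
  refine ⟨⌈(δ₀ : ℝ) ^ (τ - 2)⁻¹⌉₊, fun n hn => ?_⟩
  have hx : (δ₀ : ℝ) ^ (τ - 2)⁻¹ ≤ (n : ℝ) := (Nat.le_ceil _).trans (by exact_mod_cast hn)
  calc (δ₀ : ℝ) = ((δ₀ : ℝ) ^ (τ - 2)⁻¹) ^ (τ - 2) := (Real.rpow_inv_rpow (Nat.cast_nonneg δ₀) hτ'.ne').symm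
    _ ≤ (n : ℝ) ^ (τ - 2) := Real.rpow_le_rpow (Real.rpow_nonneg (Nat.cast_nonneg δ₀) _) hx hτ'.le

/-- **BOUNDED WIDTH IS NEVER AN OBSTRUCTION (the literal sub-family of `P_O`, with its own `n₀`).**  For every fixed `δ₀`:
`∀ τ > 2, ∃ n₀, ∀ n ≥ n₀, ∀ m ≥ n², n^τ`, every type with a slot of width `≤ δ₀` satisfies the clause of `P_O` —
`n₀ = ⌈δ₀^{1/(τ-2)}⌉`.  This discharges, as stated in the item, every fixed-width rectangular sector of `P_O`. [this node] -/
theorem noOccurrenceObstruction_boundedWidth (δ₀ : ℕ) :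
    ∀ τ : ℝ, 2 < τ → ∃ n₀ : ℕ, ∀ n m : ℕ, n₀ ≤ n → ∀ h : n * n ≤ m, (n : ℝ) ^ τ ≤ (m : ℝ) →
      ∀ (Λ : Fin 3 → Fin m → ℕ) (d : ℕ), (∃ s, ∀ a, Λ s a ≤ δ₀) →
        hwvSpace Λ d ≤ orbitVanishing (unitTensor ℂ m) → hwvSpace Λ d ≤ orbitVanishing (padMM ℂ n m h) := by
  intro τ hτ
  obtain ⟨n₀, hn₀⟩ := eventually_le_rpow_sub_two δ₀ hτ
  refine ⟨n₀, fun n m hn h hτm Λ d ⟨s, hs⟩ hU => clause_of_parts_le_rpow h hτm Λ d s (fun a => ?_) hU⟩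
  exact le_trans (by exact_mod_cast hs a) (hn₀ n hn)

/-- **`h₁^{2-rect}` of NODE-g45 §4 is a theorem as stated** (two rectangular slots of width `2`, any `N`, any third slot —
only the first slot is used): the literal restriction of `P_O` to the two-rectangular sector of width `2` holds, with
`n₀ = ⌈√2⌉`-type threshold `⌈2^{1/(τ-2)}⌉`; no duality and no Kronecker tables are needed at the scales of the item. [this node] -/
theorem noOccurrenceObstruction_twoRectangular :
    ∀ τ : ℝ, 2 < τ → ∃ n₀ : ℕ, ∀ n m : ℕ, n₀ ≤ n → ∀ h : n * n ≤ m, (n : ℝ) ^ τ ≤ (m : ℝ) →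
      ∀ (Λ : Fin 3 → Fin m → ℕ) (d : ℕ), (∀ a, Λ 0 a = 0 ∨ Λ 0 a = 2) → (∀ a, Λ 1 a = 0 ∨ Λ 1 a = 2) →
        hwvSpace Λ d ≤ orbitVanishing (unitTensor ℂ m) → hwvSpace Λ d ≤ orbitVanishing (padMM ℂ n m h) := by
  intro τ hτ
  obtain ⟨n₀, hn₀⟩ := noOccurrenceObstruction_boundedWidth 2 τ hτ
  refine ⟨n₀, fun n m hn h hτm Λ d h0 _ hU => hn₀ n m hn h hτm Λ d ⟨0, fun a => ?_⟩ hU⟩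
  rcases h0 a with ha | ha <;> simp [ha]

/-! ### §4 · The localisation of `P_O` acquires fatness in every slot -/

/-- **`P_O` lives on the FAT core window.**  `NoOccurrenceObstruction` is EQUIVALENT to its restriction to the gen-26 core window
(`τ < 4`, `d > m`, at most `n²` parts per slot, more than `m` part-pairs per slot pair) AND fatness in every slot: each of the
three partitions has a part `λ⁽ˢ⁾_a` with `λ⁽ˢ⁾_a · n² > m` (wide) and more than `m/n²` parts, `ℓ_s · n² > m` (tall).  (A dead type
needs nothing; a live window type is wide in every slot by `exists_fat_part_of_window` and tall by `rows_mul_sq_gt_of_window`.)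
[this node] -/
theorem noOccurrenceObstruction_iff_fatCore : NoOccurrenceObstruction ↔
    ∀ τ : ℝ, 2 < τ → τ < 4 → ∃ n₀ : ℕ, ∀ n m : ℕ, n₀ ≤ n → ∀ h : n * n ≤ m, (n : ℝ) ^ τ ≤ (m : ℝ) →
      ∀ (Λ : Fin 3 → Fin m → ℕ) (d : ℕ), m < d → (∀ s, (Finset.univ.filter fun a => Λ s a ≠ 0).card ≤ n * n) →
        m < (Finset.univ.filter fun a => Λ 0 a ≠ 0).card * (Finset.univ.filter fun a => Λ 1 a ≠ 0).card →
        m < (Finset.univ.filter fun a => Λ 0 a ≠ 0).card * (Finset.univ.filter fun a => Λ 2 a ≠ 0).card →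
        m < (Finset.univ.filter fun a => Λ 1 a ≠ 0).card * (Finset.univ.filter fun a => Λ 2 a ≠ 0).card →
        (∀ s, ∃ a, m < Λ s a * (n * n)) → (∀ s, m < (Finset.univ.filter fun a => Λ s a ≠ 0).card * (n * n)) →
          hwvSpace Λ d ≤ orbitVanishing (unitTensor ℂ m) → hwvSpace Λ d ≤ orbitVanishing (padMM ℂ n m h) := by
  rw [noOccurrenceObstruction_iff_core]
  refine ⟨fun H τ hτ hτ4 => ?_, fun H τ hτ hτ4 => ?_⟩
  · obtain ⟨n₀, hn₀⟩ := H τ hτ hτ4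
    exact ⟨n₀, fun n m hn h hτm Λ d hd hp h01 h02 h12 _ _ hU => hn₀ n m hn h hτm Λ d hd hp h01 h02 h12 hU⟩
  · obtain ⟨n₀, hn₀⟩ := H τ hτ hτ4
    refine ⟨n₀, fun n m hn h hτm Λ d hd hp h01 h02 h12 hU => ?_⟩
    by_cases hne : hwvSpace Λ d = ⊥
    · rw [hne]; exact bot_le
    · exact hn₀ n m hn h hτm Λ d hd hp h01 h02 h12 (exists_fat_part_of_window hne hp hd)
        (rows_mul_sq_gt_of_window hp h01 h02) hU

/-- **The fat residual implies `P_O` by name** (the form a prover of item 29040 is left with after this node: window types, fat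
in all three slots). [this node] -/
theorem noOccurrenceObstruction_of_fatCore
    (H : ∀ τ : ℝ, 2 < τ → τ < 4 → ∃ n₀ : ℕ, ∀ n m : ℕ, n₀ ≤ n → ∀ h : n * n ≤ m, (n : ℝ) ^ τ ≤ (m : ℝ) →
      ∀ (Λ : Fin 3 → Fin m → ℕ) (d : ℕ), m < d → (∀ s, (Finset.univ.filter fun a => Λ s a ≠ 0).card ≤ n * n) →
        m < (Finset.univ.filter fun a => Λ 0 a ≠ 0).card * (Finset.univ.filter fun a => Λ 1 a ≠ 0).card →
        m < (Finset.univ.filter fun a => Λ 0 a ≠ 0).card * (Finset.univ.filter fun a => Λ 2 a ≠ 0).card →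
        m < (Finset.univ.filter fun a => Λ 1 a ≠ 0).card * (Finset.univ.filter fun a => Λ 2 a ≠ 0).card →
        (∀ s, ∃ a, m < Λ s a * (n * n)) → (∀ s, m < (Finset.univ.filter fun a => Λ s a ≠ 0).card * (n * n)) →
          hwvSpace Λ d ≤ orbitVanishing (unitTensor ℂ m) → hwvSpace Λ d ≤ orbitVanishing (padMM ℂ n m h)) :
    NoOccurrenceObstruction :=
  noOccurrenceObstruction_iff_fatCore.2 H

/-- NEC of the fat residual: `ω(ℂ) = 2 ⟹ P_O|fat-core`. [this node] -/
theorem fatCore_of_summit (hS : _root_.MatrixMultiplication) :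
    ∀ τ : ℝ, 2 < τ → τ < 4 → ∃ n₀ : ℕ, ∀ n m : ℕ, n₀ ≤ n → ∀ h : n * n ≤ m, (n : ℝ) ^ τ ≤ (m : ℝ) →
      ∀ (Λ : Fin 3 → Fin m → ℕ) (d : ℕ), m < d → (∀ s, (Finset.univ.filter fun a => Λ s a ≠ 0).card ≤ n * n) →
        m < (Finset.univ.filter fun a => Λ 0 a ≠ 0).card * (Finset.univ.filter fun a => Λ 1 a ≠ 0).card →
        m < (Finset.univ.filter fun a => Λ 0 a ≠ 0).card * (Finset.univ.filter fun a => Λ 2 a ≠ 0).card →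
        m < (Finset.univ.filter fun a => Λ 1 a ≠ 0).card * (Finset.univ.filter fun a => Λ 2 a ≠ 0).card →
        (∀ s, ∃ a, m < Λ s a * (n * n)) → (∀ s, m < (Finset.univ.filter fun a => Λ s a ≠ 0).card * (n * n)) →
          hwvSpace Λ d ≤ orbitVanishing (unitTensor ℂ m) → hwvSpace Λ d ≤ orbitVanishing (padMM ℂ n m h) :=
  noOccurrenceObstruction_iff_fatCore.1
    (Summit.MatrixMultiplication.MatrixMultiplication.Theorems.ObstructionDescentInformationAxis.noOccurrenceObstruction_of_summit
      hS)

end Summit.MatrixMultiplication.MatrixMultiplication.Theorems.ObstructionDescentThinTypes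

end
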